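import Summits.ABC.ABC.Theorems.DefiniteXiDefiniteRTControlPrimeOfTakahashi
import Literature.NumberTheory.EllipticCurves.PastenHeightBoundsLemma68LocalProofs
import Literature.NumberTheory.EllipticCurves.RationalIsogenyDegreesProofs
import HarnessLib

/-!
# Stub-ideation k2 · gen 14 — `stub_pastenLemma68` (crux `DefiniteRTControlPrime`, stmt-ABC-11338)

Companion to `STUB-IDEAS-stub_pastenLemma68-2.md` (gen 14).  FAMILY 2 (RESHAPE), typed:
the **constant ladder** `Lemma68With B` (Pasten 2024, Lemma 6.8 with `163 ↦ B`), its cyclic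
normal form, the radius-to-lemma transport for every `B`, and the converse "every uniform `B` is a
Mazur-type statement" (prime isogeny degrees `≤ B` at a multiplicative place) — plus by-name
certificates that the sheet's assembly constants resolve in today's tree.  No `sorry`.
-/

set_option linter.dupNamespace false

namespace Summit.ABC.ABC.Cruxes.DefiniteRTControlPrime.StubIdeasK2G14

open Literature.NumberTheory.EllipticCurves Literature.NumberTheory.EllipticCurves.ModularForms
open WeierstrassCurve IsDedekindDomain
open scoped Classical

/-! ## 0 · By-name certificates (the sheet's assembly) -/

/-- The crux from Takahashi 2001 Thm 2.3 (coprime form) ALONE — landed p839521. -/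
example (hT : takahashi2001_thm_2_3_of_coprime) :
    Summit.ABC.ABC.Theses.DefiniteXi.DefiniteRTControlPrime :=
  Summit.ABC.ABC.Theorems.DefiniteRTControlPrime.definiteRTControlPrime_of_takahashi hT

/-- The stub's only closer: Mazur–Kenku (named fact, = item stmt-ABC-15193 up to cyclicity). -/
example (hMK : mazurKenku_exists_cyclic_isogeny) : PastenShimura2024_lemma_6_8 :=
  PastenShimura2024_lemma_6_8_of_mazurKenku' hMK

/-- The stub is Mazur-deep as typed: it bounds prime isogeny degrees at a multiplicative place. -/
example (h68 : PastenShimura2024_lemma_6_8) {W W' : WeierstrassCurve ℚ} [W.IsElliptic]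
    [W'.IsElliptic] (φ : Isogeny W W') {ℓ : ℕ} (hℓ : ℓ.Prime) (hdeg : φ.degree = ℓ)
    (v : HeightOneSpectrum ℤ) (hv : W.HasMultiplicativeReductionAt v) : ℓ ≤ 163 :=
  prime_degree_le_163_of_PastenShimura2024_lemma_6_8 h68 φ hℓ hdeg v hv

/-! ## 1 · The constant ladder `Lemma68With B` -/

/-- Pasten 2024 Lemma 6.8 with the constant `163` replaced by a parameter `B`. -/
def Lemma68With (B : ℕ) : Prop :=
  ∀ (W W' : WeierstrassCurve ℚ) [W.IsElliptic] [W'.IsElliptic], W.IsIsogenous W' →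
    ∀ v : HeightOneSpectrum ℤ, W.HasMultiplicativeReductionAt v →
      ∃ m n : ℕ, 0 < m ∧ m ≤ B ∧ 0 < n ∧ n ≤ B ∧
        W.ordMinimalDiscriminant v * n = W'.ordMinimalDiscriminant v * m

/-- The typed stub is the rung `B = 163`, definitionally. -/
theorem lemma68With_163_iff : Lemma68With 163 ↔ PastenShimura2024_lemma_6_8 := Iff.rfl

/-- The ladder is monotone in `B`. -/
theorem Lemma68With.mono {B B' : ℕ} (h : Lemma68With B) (hBB' : B ≤ B') : Lemma68With B' := by
  intro W W' _ _ hiso v hv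
  obtain ⟨m, n, hm, hmB, hn, hnB, hmn⟩ := h W W' hiso v hv
  exact ⟨m, n, hm, hmB.trans hBB', hn, hnB.trans hBB', hmn⟩

/-- **Cyclic normal form** ("exact content"): the Tate imbalance of CYCLIC `ℚ`-isogenies out of a
curve with a multiplicative place is `≤ B` (numerator and denominator of `c_v(W')/c_v(W)`). -/
def CyclicTateImbalanceLe (B : ℕ) : Prop :=
  ∀ (W W' : WeierstrassCurve ℚ) [W.IsElliptic] [W'.IsElliptic] (φ : Isogeny W W'), φ.IsCyclic →
    ∀ v : HeightOneSpectrum ℤ, W.HasMultiplicativeReductionAt v →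
      ∃ m n : ℕ, 0 < m ∧ m ≤ B ∧ 0 < n ∧ n ≤ B ∧
        W.ordMinimalDiscriminant v * n = W'.ordMinimalDiscriminant v * m

/-- `Lemma68With B` is a statement about cyclic isogenies only (cyclic companion,
`IsIsogenous.exists_isCyclic`, AEC III.4.11). -/
theorem lemma68With_iff_cyclic (B : ℕ) : Lemma68With B ↔ CyclicTateImbalanceLe B := by
  constructor
  · intro h W W' _ _ φ _ v hv
    exact h W W' ⟨φ⟩ v hv
  · intro h W W' _ _ hiso v hv
    obtain ⟨ψ, hψ⟩ := hiso.exists_isCyclic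
    exact h W W' ψ hψ v hv

/-- **Radius ⇒ rung** for every `B` (the printed proof of Lemma 6.8, constant-free): an isogeny
radius `B` for the pair gives the rung `B`, Mazur-free, via the cyclic companion and the tree's
cyclic transport `exists_ordMinimalDiscriminant_mul_eq_mul_of_isCyclic`. -/
theorem lemma68With_of_radius (B : ℕ)
    (hR : ∀ (W W' : WeierstrassCurve ℚ) [W.IsElliptic] [W'.IsElliptic], W.IsIsogenous W' →
      ∃ φ : Isogeny W W', φ.degree ≤ B) :
    Lemma68With B := by
  intro W W' _ _ hiso v hv
  have hv' : W'.HasMultiplicativeReductionAt v := hasMultiplicativeReductionAt_of_isIsogenous hiso v hv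
  obtain ⟨φ, hφ⟩ := hR W W' hiso
  obtain ⟨ψ, hψ, hdvd⟩ := φ.exists_isCyclic_degree_dvd
  have hψB : ψ.degree ≤ B := (Nat.le_of_dvd φ.degree_pos hdvd).trans hφ
  obtain ⟨a, b, ha, hb, hab, h⟩ :=
    exists_ordMinimalDiscriminant_mul_eq_mul_of_isCyclic ψ.degree ψ hψ rfl v hv hv'
  have habn : a * b ≤ ψ.degree := Nat.le_of_dvd ψ.degree_pos hab
  refine ⟨a, b, ha, ?_, hb, ?_, h⟩
  · have : a ≤ a * b := Nat.le_mul_of_pos_right a hb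
    omega
  · have : b ≤ a * b := Nat.le_mul_of_pos_left b ha
    omega

/-- In particular the radius ITEM `MazurKenkuRadius` (stmt-ABC-15193, aside) closes the stub. -/
theorem stub_of_radiusItem (hR : Summit.ABC.ABC.Theses.DefiniteXi.MazurKenkuRadius) :
    PastenShimura2024_lemma_6_8 :=
  lemma68With_163_iff.mp (lemma68With_of_radius 163 fun W W' _ _ h => hR W W' h)

/-- **Every uniform rung is Mazur-type**: `Lemma68With B` forbids `ℚ`-isogenies of prime degree
`ℓ > B` out of any curve with a multiplicative place (for `B = 163`: Mazur 1978 Thm 1 at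
non-integral `j`; the tree's `prime_degree_le_163_of_PastenShimura2024_lemma_6_8`, constant freed). -/
theorem prime_degree_le_of_lemma68With {B : ℕ} (h : Lemma68With B)
    {W W' : WeierstrassCurve ℚ} [W.IsElliptic] [W'.IsElliptic] (φ : Isogeny W W') {ℓ : ℕ}
    (hℓ : ℓ.Prime) (hdeg : φ.degree = ℓ) (v : HeightOneSpectrum ℤ)
    (hv : W.HasMultiplicativeReductionAt v) : ℓ ≤ B := by
  have hv' : W'.HasMultiplicativeReductionAt v :=
    hasMultiplicativeReductionAt_of_isIsogenous ⟨φ⟩ v hv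
  obtain ⟨m, n, hm, hmB, hn, hnB, hmn⟩ := h W W' ⟨φ⟩ v hv
  have hc := Nat.pos_of_ne_zero
    (WeierstrassCurve.ordMinimalDiscriminant_ne_zero_of_hasMultiplicativeReductionAt v W hv)
  have hc' := Nat.pos_of_ne_zero
    (WeierstrassCurve.ordMinimalDiscriminant_ne_zero_of_hasMultiplicativeReductionAt v W' hv')
  rcases ordMinimalDiscriminant_eq_mul_or_of_degree_eq_prime φ hℓ hdeg v hv hv' with h1 | h1
  · rw [h1] at hmn
    have h2 : ℓ * n = m := by
      have : W'.ordMinimalDiscriminant v * (ℓ * n) = W'.ordMinimalDiscriminant v * m := by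
        rw [← hmn]; ring
      exact Nat.eq_of_mul_eq_mul_left hc' this
    nlinarith
  · rw [h1] at hmn
    have h2 : n = ℓ * m := by
      have : W.ordMinimalDiscriminant v * n = W.ordMinimalDiscriminant v * (ℓ * m) := by
        rw [hmn]; ring
      exact Nat.eq_of_mul_eq_mul_left hc this
    nlinarith

/-! ## 2 · The rung that IS proved (non-uniform, Mazur-free): `163 ↦ R_ε N^ε` on Frey sources -/

/-- The landed sub-polynomial isogeny radius of a Frey class (k2-g12 chain, p839521 part 7). -/
example : Summit.ABC.ABC.Theorems.DefiniteRTControlPrime.OfTakahashi.FreyIsogenyRadiusSubpoly :=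
  Summit.ABC.ABC.Theorems.DefiniteRTControlPrime.OfTakahashi.freyIsogenyRadiusSubpoly

/-- **Frey valuation transport with constant `R_ε N^ε`** — the instance of Lemma 6.8 the registered
composition consumes (`stub_valTransport`: Frey source, odd `q ∣ N`, class-mate `W'`), with `163`
replaced by the proved radius: `v_q(Δ_min W') ≤ R_ε N^ε · v_q(Δ_min E_(a,b))`.  PROVED here from
the landed radius and the landed one-isogeny transport `OfTakahashi.factorization_le_mul_of_isogeny`
— i.e. the stub's rôle in the skeleton is dischargeable today WITHOUT Mazur–Kenku. -/
theorem freyValTransportSubpoly :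
    ∀ ε : ℝ, 0 < ε → ∃ R : ℝ, ∀ (a b : ℤ), IsCoprime a b → a * b * (a + b) ≠ 0 →
      ∀ q : ℕ, q.Prime → q ≠ 2 → q ∣ (freyCurve a b).conductorNorm ℤ →
        ∀ (W' : WeierstrassCurve ℚ) [W'.IsElliptic], (freyCurve a b).IsIsogenous W' →
          ((W'.minimalDiscriminantNorm ℤ).factorization q : ℝ) ≤
            R * (((freyCurve a b).conductorNorm ℤ : ℕ) : ℝ) ^ ε *
              (((freyCurve a b).minimalDiscriminantNorm ℤ).factorization q : ℝ) := by
  intro ε hε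
  obtain ⟨R, hR⟩ :=
    Summit.ABC.ABC.Theorems.DefiniteRTControlPrime.OfTakahashi.freyIsogenyRadiusSubpoly ε hε
  refine ⟨R, fun a b hab h0 q hq hq2 hqN W' _ hiso => ?_⟩
  obtain ⟨φ, hφ⟩ := hR a b hab h0 q hq hq2 hqN W' hiso
  have hv :=
    Summit.ABC.ABC.Theorems.DefiniteRTControlPrime.OfTakahashi.factorization_le_mul_of_isogeny
      hab h0 hq hq2 hqN φ le_rfl
  have h1 : ((W'.minimalDiscriminantNorm ℤ).factorization q : ℝ) ≤
      (φ.degree : ℝ) * (((freyCurve a b).minimalDiscriminantNorm ℤ).factorization q : ℝ) := by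
    exact_mod_cast hv
  have h2 : (0 : ℝ) ≤ (((freyCurve a b).minimalDiscriminantNorm ℤ).factorization q : ℝ) := by
    positivity
  calc ((W'.minimalDiscriminantNorm ℤ).factorization q : ℝ)
      ≤ (φ.degree : ℝ) * (((freyCurve a b).minimalDiscriminantNorm ℤ).factorization q : ℝ) := h1
    _ ≤ R * (((freyCurve a b).conductorNorm ℤ : ℕ) : ℝ) ^ ε *
          (((freyCurve a b).minimalDiscriminantNorm ℤ).factorization q : ℝ) :=
        mul_le_mul_of_nonneg_right hφ h2

end Summit.ABC.ABC.Cruxes.DefiniteRTControlPrime.StubIdeasK2G14
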